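import Summits.CriticalPhenomena.PercolationContinuityZ3.Theorems.PercNearOneGluingNoHeavyLowerTailKnQuestion8CoefficientwiseCoreClassKernelMixIETLayerCake
import HarnessLib

/-!
# Mixing (re-coupling) inequalities for the IET functional

Support file (`--supports stmt-CriticalPhenomena-4575`, closed), prover `prim-cplus-coupling` (gen 54).  No definitions, no notations, no named facts,
no sorries; standard axioms.  Memo `prim-cplus-coupling/A5-COUPLING-gen54.md` §2.

The IET functional of the lane (gens 37–53; `Coefficientwise.iet_of_indicator_levels`, `Coefficientwise.iet_split_shortThread`)
  `S(h,k; hᵃ,hᵇ; kᵃ,kᵇ)(𝒱) = Σ_{𝒱, supply} h(X) k(X) + Σ_{𝒱, demand} (hᵃ(X) − hᵇ(Y)) (kᵃ(X) − kᵇ(Y))`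
is bilinear in the triples `(h,hᵃ,hᵇ)`, `(k,kᵃ,kᵇ)`, and its supply part depends only on `(h,k)`, its demand part only on `(hᵃ,hᵇ,kᵃ,kᵇ)`.
Consequently it is SUPERMODULAR separately in the pair of target levels `(h,k)` and in the pair of demand levels `(hᵇ,kᵇ)`:
* `Coefficientwise.ietSum_targets_mix_eq`:  `S(h,k) + S(h′,k′) = S(h,k′) + S(h′,k) + Σ_{supply} (h′−h)(k′−k)(X)`;
* `Coefficientwise.ietSum_demand_mix_eq`:   `S(hᵇ,kᵇ) + S(hᵇ′,kᵇ′) = S(hᵇ,kᵇ′) + S(hᵇ′,kᵇ) + Σ_{demand} (hᵇ′−hᵇ)(kᵇ′−kᵇ)(Y)`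
(exact identities, no sign or admissibility hypotheses).  The use (`Coefficientwise.ietSum_mixing_nonneg`, cluster form
`Coefficientwise.iet_graph_mixing_nonneg`): when a slice of an IET sum carries demand levels `hᵇ′ ≥ hᵇ, kᵇ′ ≥ kᵇ` that are NOT dominated by its
target levels `h, k` (an 'illegitimate instance' — the invalid words of THEOREM A for threads of length ≥ 3, the blue slice of a pendant edge), while
a partner slice on the same event has the larger targets `h′ ≥ h, k′ ≥ k` and the smaller demand levels, then the sum of the two slices dominates
the sum of the two MIXED instances `S(h,k′; hᵇ,kᵇ′) + S(h′,k; hᵇ′,kᵇ)`, each of which can be a legitimate instance (`hᵇ ≤ h`, `kᵇ′ ≤ k′`, `hᵇ′ ≤ h′`,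
`kᵇ ≤ k`): two-type 're-coupling' by exchanging ONE of the two observers' shifts (memo §2.3; the equal-event half of the pendant-edge step).
[cite: KozmaNitzan2024, Questions 8–9 (§5.5 p. 36) (context); Harris 1960]
-/

namespace Summit.CriticalPhenomena.PercolationContinuityZ3.Theorems

open Finset Literature.Probability.Percolation

namespace Coefficientwise

variable {ι V : Type*}

/-- **Target mixing identity.**  For the abstract IET sum (index set `E`, supply/demand predicates `RD, DD`, maps `X, Y`), exchanging the
target levels between two systems that share everything else costs exactly `Σ_{supply} (h′−h)(k′−k)(X)`:
`S(h,k) + S(h′,k′) = S(h,k′) + S(h′,k) + Σ_{RD} (h′ X − h X)(k′ X − k X)`.  Pure algebra, pointwise. -/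
theorem ietSum_targets_mix_eq [DecidableEq ι] (E : Finset ι) (RD DD : Finset ι → Prop) [DecidablePred RD] [DecidablePred DD]
    (X Y : Finset ι → Set V) (h k h' k' ha hb ka kb : Set V → ℝ) :
    ((∑ ω ∈ E.powerset, if RD ω then h (X ω) * k (X ω) else 0)
        + ∑ ω ∈ E.powerset, if DD ω then (ha (X ω) - hb (Y ω)) * (ka (X ω) - kb (Y ω)) else 0)
      + ((∑ ω ∈ E.powerset, if RD ω then h' (X ω) * k' (X ω) else 0)
        + ∑ ω ∈ E.powerset, if DD ω then (ha (X ω) - hb (Y ω)) * (ka (X ω) - kb (Y ω)) else 0)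
    = ((∑ ω ∈ E.powerset, if RD ω then h (X ω) * k' (X ω) else 0)
        + ∑ ω ∈ E.powerset, if DD ω then (ha (X ω) - hb (Y ω)) * (ka (X ω) - kb (Y ω)) else 0)
      + ((∑ ω ∈ E.powerset, if RD ω then h' (X ω) * k (X ω) else 0)
        + ∑ ω ∈ E.powerset, if DD ω then (ha (X ω) - hb (Y ω)) * (ka (X ω) - kb (Y ω)) else 0)
      + ∑ ω ∈ E.powerset, if RD ω then (h' (X ω) - h (X ω)) * (k' (X ω) - k (X ω)) else 0 := by
  have hpt : ∀ ω ∈ E.powerset,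
      (if RD ω then h (X ω) * k (X ω) else 0) + (if RD ω then h' (X ω) * k' (X ω) else 0)
        = (if RD ω then h (X ω) * k' (X ω) else 0) + (if RD ω then h' (X ω) * k (X ω) else 0)
          + (if RD ω then (h' (X ω) - h (X ω)) * (k' (X ω) - k (X ω)) else 0) := by
    intro ω _
    split_ifs <;> ring
  have hsum := Finset.sum_congr rfl hpt
  rw [Finset.sum_add_distrib, Finset.sum_add_distrib, Finset.sum_add_distrib] at hsum
  linarith

/-- **Demand mixing identity.**  Exchanging the demand levels `(hᵇ,kᵇ) ↔ (hᵇ′,kᵇ′)` between two systems that share everything else costs exactly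
`Σ_{demand} (hᵇ′−hᵇ)(kᵇ′−kᵇ)(Y)`:  `S(hᵇ,kᵇ) + S(hᵇ′,kᵇ′) = S(hᵇ,kᵇ′) + S(hᵇ′,kᵇ) + Σ_{DD} (hᵇ′ Y − hᵇ Y)(kᵇ′ Y − kᵇ Y)`.  Pure algebra. -/
theorem ietSum_demand_mix_eq [DecidableEq ι] (E : Finset ι) (RD DD : Finset ι → Prop) [DecidablePred RD] [DecidablePred DD]
    (X Y : Finset ι → Set V) (h k ha ka hb kb hb' kb' : Set V → ℝ) :
    ((∑ ω ∈ E.powerset, if RD ω then h (X ω) * k (X ω) else 0)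
        + ∑ ω ∈ E.powerset, if DD ω then (ha (X ω) - hb (Y ω)) * (ka (X ω) - kb (Y ω)) else 0)
      + ((∑ ω ∈ E.powerset, if RD ω then h (X ω) * k (X ω) else 0)
        + ∑ ω ∈ E.powerset, if DD ω then (ha (X ω) - hb' (Y ω)) * (ka (X ω) - kb' (Y ω)) else 0)
    = ((∑ ω ∈ E.powerset, if RD ω then h (X ω) * k (X ω) else 0)
        + ∑ ω ∈ E.powerset, if DD ω then (ha (X ω) - hb (Y ω)) * (ka (X ω) - kb' (Y ω)) else 0)
      + ((∑ ω ∈ E.powerset, if RD ω then h (X ω) * k (X ω) else 0)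
        + ∑ ω ∈ E.powerset, if DD ω then (ha (X ω) - hb' (Y ω)) * (ka (X ω) - kb (Y ω)) else 0)
      + ∑ ω ∈ E.powerset, if DD ω then (hb' (Y ω) - hb (Y ω)) * (kb' (Y ω) - kb (Y ω)) else 0 := by
  have hpt : ∀ ω ∈ E.powerset,
      (if DD ω then (ha (X ω) - hb (Y ω)) * (ka (X ω) - kb (Y ω)) else 0)
        + (if DD ω then (ha (X ω) - hb' (Y ω)) * (ka (X ω) - kb' (Y ω)) else 0)
        = (if DD ω then (ha (X ω) - hb (Y ω)) * (ka (X ω) - kb' (Y ω)) else 0)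
          + (if DD ω then (ha (X ω) - hb' (Y ω)) * (ka (X ω) - kb (Y ω)) else 0)
          + (if DD ω then (hb' (Y ω) - hb (Y ω)) * (kb' (Y ω) - kb (Y ω)) else 0) := by
    intro ω _
    split_ifs <;> ring
  have hsum := Finset.sum_congr rfl hpt
  rw [Finset.sum_add_distrib, Finset.sum_add_distrib, Finset.sum_add_distrib] at hsum
  linarith

/-- **Mixing inequality (abstract form).**  Two IET systems on the same index set, predicates and maps, with common source levels `hᵃ, kᵃ`:
system 1 has targets `(h′,k′)` and demand levels `(hᵇ,kᵇ)`, system 2 has targets `(h,k)` and demand levels `(hᵇ′,kᵇ′)`, where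
`h ≤ h′`, `k ≤ k′`, `hᵇ ≤ hᵇ′`, `kᵇ ≤ kᵇ′` pointwise (system 2 may be 'illegitimate': `hᵇ′ ≤ h` is not assumed).  If the two MIXED systems
`(h,k′; hᵇ,kᵇ′)` and `(h′,k; hᵇ′,kᵇ)` have nonnegative sums, then so does system 1 + system 2:
`S₁ + S₂ ≥ S(h,k′;hᵇ,kᵇ′) + S(h′,k;hᵇ′,kᵇ) ≥ 0`, the slack being `Σ_{RD}(h′−h)(k′−k)(X) + Σ_{DD}(hᵇ′−hᵇ)(kᵇ′−kᵇ)(Y) ≥ 0`. -/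
theorem ietSum_mixing_nonneg [DecidableEq ι] (E : Finset ι) (RD DD : Finset ι → Prop) [DecidablePred RD] [DecidablePred DD]
    (X Y : Finset ι → Set V) (h k h' k' ha ka hb kb hb' kb' : Set V → ℝ)
    (hh : ∀ S, h S ≤ h' S) (hk : ∀ S, k S ≤ k' S) (hhb : ∀ S, hb S ≤ hb' S) (hkb : ∀ S, kb S ≤ kb' S)
    (mix1 : 0 ≤ (∑ ω ∈ E.powerset, if RD ω then h (X ω) * k' (X ω) else 0)
        + ∑ ω ∈ E.powerset, if DD ω then (ha (X ω) - hb (Y ω)) * (ka (X ω) - kb' (Y ω)) else 0)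
    (mix2 : 0 ≤ (∑ ω ∈ E.powerset, if RD ω then h' (X ω) * k (X ω) else 0)
        + ∑ ω ∈ E.powerset, if DD ω then (ha (X ω) - hb' (Y ω)) * (ka (X ω) - kb (Y ω)) else 0) :
    0 ≤ ((∑ ω ∈ E.powerset, if RD ω then h' (X ω) * k' (X ω) else 0)
          + ∑ ω ∈ E.powerset, if DD ω then (ha (X ω) - hb (Y ω)) * (ka (X ω) - kb (Y ω)) else 0)
        + ((∑ ω ∈ E.powerset, if RD ω then h (X ω) * k (X ω) else 0)
          + ∑ ω ∈ E.powerset, if DD ω then (ha (X ω) - hb' (Y ω)) * (ka (X ω) - kb' (Y ω)) else 0) := by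
  -- pointwise domination of the two mixed summands by the two actual summands
  have hR : ∀ ω ∈ E.powerset,
      (if RD ω then h (X ω) * k' (X ω) else 0) + (if RD ω then h' (X ω) * k (X ω) else 0)
        ≤ (if RD ω then h' (X ω) * k' (X ω) else 0) + (if RD ω then h (X ω) * k (X ω) else 0) := by
    intro ω _
    split_ifs
    · nlinarith [mul_nonneg (sub_nonneg.mpr (hh (X ω))) (sub_nonneg.mpr (hk (X ω)))]
    · simp
  have hD : ∀ ω ∈ E.powerset,
      (if DD ω then (ha (X ω) - hb (Y ω)) * (ka (X ω) - kb' (Y ω)) else 0)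
        + (if DD ω then (ha (X ω) - hb' (Y ω)) * (ka (X ω) - kb (Y ω)) else 0)
        ≤ (if DD ω then (ha (X ω) - hb (Y ω)) * (ka (X ω) - kb (Y ω)) else 0)
          + (if DD ω then (ha (X ω) - hb' (Y ω)) * (ka (X ω) - kb' (Y ω)) else 0) := by
    intro ω _
    split_ifs
    · nlinarith [mul_nonneg (sub_nonneg.mpr (hhb (Y ω))) (sub_nonneg.mpr (hkb (Y ω)))]
    · simp
  have hRs := Finset.sum_le_sum hR
  have hDs := Finset.sum_le_sum hD
  rw [Finset.sum_add_distrib, Finset.sum_add_distrib] at hRs hDs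
  linarith

open Classical in
/-- **Mixing inequality (cluster form).**  On a finite multigraph (`ends`, `E`) with root `u`, observer `b` and an event `𝒱`, in the lane's cluster
notation `X = C_u(ω)`, `Y = C_u(E∖ω)`, supply `b ∈ X∖Y`, demand `b ∈ Y∖X`: if `h ≤ h′`, `k ≤ k′`, `hᵇ ≤ hᵇ′`, `kᵇ ≤ kᵇ′` pointwise and the two
mixed IET sums `(h,k′;hᵃ,hᵇ;kᵃ,kᵇ′)`, `(h′,k;hᵃ,hᵇ′;kᵃ,kᵇ)` on `𝒱` are nonnegative, then the sum of the IET sums `(h′,k′;hᵃ,hᵇ;kᵃ,kᵇ)` and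
`(h,k;hᵃ,hᵇ′;kᵃ,kᵇ′)` on `𝒱` is nonnegative.  Typical use: `h′ = h(· ∪ T)`, `hᵇ′ = hᵇ(· ∪ T)` (levels shifted by a vertex set `T` hanging from `b`),
where the second system is the illegitimate slice and the two mixed systems are legitimate IET instances (memo §2.3). -/
theorem iet_graph_mixing_nonneg (ends : ι → Sym2 V) (E : Finset ι) (u b : V) (𝒱 : Finset ι → Prop)
    (h k h' k' ha ka hb kb hb' kb' : Set V → ℝ)
    (hh : ∀ S, h S ≤ h' S) (hk : ∀ S, k S ≤ k' S) (hhb : ∀ S, hb S ≤ hb' S) (hkb : ∀ S, kb S ≤ kb' S)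
    (mix1 : 0 ≤ (∑ ω ∈ E.powerset, if 𝒱 ω ∧ b ∈ openCluster (ends '' (↑ω : Set ι)) u ∧ b ∉ openCluster (ends '' (↑(E \ ω) : Set ι)) u then
          h (openCluster (ends '' (↑ω : Set ι)) u) * k' (openCluster (ends '' (↑ω : Set ι)) u) else 0)
        + ∑ ω ∈ E.powerset, if 𝒱 ω ∧ b ∈ openCluster (ends '' (↑(E \ ω) : Set ι)) u ∧ b ∉ openCluster (ends '' (↑ω : Set ι)) u then
          (ha (openCluster (ends '' (↑ω : Set ι)) u) - hb (openCluster (ends '' (↑(E \ ω) : Set ι)) u)) *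
            (ka (openCluster (ends '' (↑ω : Set ι)) u) - kb' (openCluster (ends '' (↑(E \ ω) : Set ι)) u)) else 0)
    (mix2 : 0 ≤ (∑ ω ∈ E.powerset, if 𝒱 ω ∧ b ∈ openCluster (ends '' (↑ω : Set ι)) u ∧ b ∉ openCluster (ends '' (↑(E \ ω) : Set ι)) u then
          h' (openCluster (ends '' (↑ω : Set ι)) u) * k (openCluster (ends '' (↑ω : Set ι)) u) else 0)
        + ∑ ω ∈ E.powerset, if 𝒱 ω ∧ b ∈ openCluster (ends '' (↑(E \ ω) : Set ι)) u ∧ b ∉ openCluster (ends '' (↑ω : Set ι)) u then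
          (ha (openCluster (ends '' (↑ω : Set ι)) u) - hb' (openCluster (ends '' (↑(E \ ω) : Set ι)) u)) *
            (ka (openCluster (ends '' (↑ω : Set ι)) u) - kb (openCluster (ends '' (↑(E \ ω) : Set ι)) u)) else 0) :
    0 ≤ ((∑ ω ∈ E.powerset, if 𝒱 ω ∧ b ∈ openCluster (ends '' (↑ω : Set ι)) u ∧ b ∉ openCluster (ends '' (↑(E \ ω) : Set ι)) u then
            h' (openCluster (ends '' (↑ω : Set ι)) u) * k' (openCluster (ends '' (↑ω : Set ι)) u) else 0)
          + ∑ ω ∈ E.powerset, if 𝒱 ω ∧ b ∈ openCluster (ends '' (↑(E \ ω) : Set ι)) u ∧ b ∉ openCluster (ends '' (↑ω : Set ι)) u then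
            (ha (openCluster (ends '' (↑ω : Set ι)) u) - hb (openCluster (ends '' (↑(E \ ω) : Set ι)) u)) *
              (ka (openCluster (ends '' (↑ω : Set ι)) u) - kb (openCluster (ends '' (↑(E \ ω) : Set ι)) u)) else 0)
        + ((∑ ω ∈ E.powerset, if 𝒱 ω ∧ b ∈ openCluster (ends '' (↑ω : Set ι)) u ∧ b ∉ openCluster (ends '' (↑(E \ ω) : Set ι)) u then
            h (openCluster (ends '' (↑ω : Set ι)) u) * k (openCluster (ends '' (↑ω : Set ι)) u) else 0)
          + ∑ ω ∈ E.powerset, if 𝒱 ω ∧ b ∈ openCluster (ends '' (↑(E \ ω) : Set ι)) u ∧ b ∉ openCluster (ends '' (↑ω : Set ι)) u then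
            (ha (openCluster (ends '' (↑ω : Set ι)) u) - hb' (openCluster (ends '' (↑(E \ ω) : Set ι)) u)) *
              (ka (openCluster (ends '' (↑ω : Set ι)) u) - kb' (openCluster (ends '' (↑(E \ ω) : Set ι)) u)) else 0) := by
  classical
  exact ietSum_mixing_nonneg E
    (fun ω => 𝒱 ω ∧ b ∈ openCluster (ends '' (↑ω : Set ι)) u ∧ b ∉ openCluster (ends '' (↑(E \ ω) : Set ι)) u)
    (fun ω => 𝒱 ω ∧ b ∈ openCluster (ends '' (↑(E \ ω) : Set ι)) u ∧ b ∉ openCluster (ends '' (↑ω : Set ι)) u)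
    (fun ω => openCluster (ends '' (↑ω : Set ι)) u) (fun ω => openCluster (ends '' (↑(E \ ω) : Set ι)) u)
    h k h' k' ha ka hb kb hb' kb' hh hk hhb hkb mix1 mix2

end Coefficientwise

end Summit.CriticalPhenomena.PercolationContinuityZ3.Theorems
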